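import Summits.Ventures.CertifiedArithmetic.Expansions.Orient2dAdapt
import Summits.Ventures.CertifiedArithmetic.Expansions.Orient2dEstimateZero
import Mathlib.Tactic.Linarith
import Mathlib.Tactic.NormNum

/-!
# ORIENT2D end to end, complement: what a ZERO answer of the adaptive predicate means

NEW WORK in the sense of this development (algorithm: Shewchuk's `predicates.c` [Shewchuk1997];
statement and proof: ours).  `Orient2dAdapt.lean` proves that a NONZERO answer of `orient2dAdapt`
has the sign of the true determinant.  Here the remaining case:

* `orient2dAdapt_eq_zero` — under the same hypotheses, **if the predicate answers `0` then EITHER the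
  true determinant is `0`, OR the answer came from the tails-zero exit in its rigid configuration**:
  the four coordinate differences are floats, the TWO-TWO-DIFF block of the two error-free products
  is `[B₀, B₁, 0, B₃]` with `B₀ ⊕ B₁ = −B₃`, and `|t_A| ≤ ulp(B₃)/2`
  (`Orient2dEstimateZero.orient2d_tailsZero_eq_zero`).  Stage A and stage D answer `0` iff
  `t_A = 0`; stages B and C never answer `0` (their theorems make both signs of `t_A` impossible).

Together with `orient2dAdapt_sign` this is the complete input/output specification of `orient2d`
in the model, up to the conjecture (open, see `Orient2dEstimateZero`) that the second alternative
forces `t_A = 0` as well.  Caveats as there: no overflow model, format hypothesis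
`emin + 3p ≤ 2e₀`, strict IEEE evaluation of the C expressions.
-/

namespace Summit.Ventures.CertifiedArithmetic.Expansions

open Literature.ComputerArithmetic.JeannerodRump2018
open Literature.ComputerArithmetic.BoldoJeannerodMelquiondMuller2023 hiding twoSum twoSum_fst isFloat_twoSum
open Literature.ComputerArithmetic.Shewchuk1997

variable {p : ℕ} {emin : ℤ} {fl : ℚ → ℚ}

/-- From `(0 < d ↔ 0 < t) ∧ (d < 0 ↔ t < 0)` and `d = 0`: `t = 0`. -/
theorem eq_zero_of_sign_iff {d t : ℚ} (h : (0 < d ↔ 0 < t) ∧ (d < 0 ↔ t < 0)) (hd : d = 0) :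
    t = 0 := by
  subst hd
  rcases lt_trichotomy t 0 with ht | ht | ht
  · exact absurd (h.2.mpr ht) (lt_irrefl 0)
  · exact ht
  · exact absurd (h.1.mpr ht) (lt_irrefl 0)

/-- **WHAT A ZERO ANSWER OF `orient2d` MEANS.**  Hypotheses as in `orient2dAdapt_sign`.  If the
adaptive predicate answers `0`, then either the true determinant vanishes, or the four coordinate
differences are floats (the tails-zero exit was taken), the block of stage B is `[B₀, B₁, 0, B₃]`
with `B₀ ⊕ B₁ = −B₃`, `B₃` a float, and `|t_A| ≤ ulp(B₃)/2`. -/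
theorem orient2dAdapt_eq_zero (hp : 4 ≤ p) (hfl : IsRoundNearest p emin fl)
    (hodd : ∀ t, fl (-t) = -fl t) (hfl2 : RoundoffBelow 2 fl)
    {fes : List ℚ → List ℚ → List ℚ} (hfes : FesSpec p emin fes) {e₀ : ℤ} (he₀ : emin ≤ e₀)
    (h3 : emin + 3 * p ≤ e₀ + e₀) {tp : ℚ → ℚ → ℚ × ℚ}
    (htp : ∀ x y, IsFloat p e₀ x → IsFloat p e₀ y → ExactTwoProd p emin fl tp x y)
    {a₁ a₂ b₁ b₂ c₁ c₂ : ℚ} (ha₁ : IsFloat p e₀ a₁) (ha₂ : IsFloat p e₀ a₂) (hb₁ : IsFloat p e₀ b₁)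
    (hb₂ : IsFloat p e₀ b₂) (hc₁ : IsFloat p e₀ c₁) (hc₂ : IsFloat p e₀ c₂)
    (hr : orient2dAdapt fes tp fl (ccwerrboundA p) (ccwerrboundB p) (ccwerrboundC p)
        (resulterrbound p) a₁ a₂ b₁ b₂ c₁ c₂ = 0) :
    orient2dDet a₁ a₂ b₁ b₂ c₁ c₂ = 0 ∨
      (IsFloat p emin (a₁ - c₁) ∧ IsFloat p emin (b₂ - c₂) ∧ IsFloat p emin (a₂ - c₂) ∧
        IsFloat p emin (b₁ - c₁) ∧
        ∃ B₀ B₁ B₃ : ℚ,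
          twoTwoProdDiff tp fl (a₁ - c₁) (b₂ - c₂) (a₂ - c₂) (b₁ - c₁) = [B₀, B₁, 0, B₃] ∧
          fl (B₀ + B₁) = -B₃ ∧ IsFloat p emin B₃ ∧
          |orient2dDet a₁ a₂ b₁ b₂ c₁ c₂| ≤ ulp p emin B₃ / 2) := by
  have hp1 : 1 ≤ p := le_trans (by norm_num) hp
  have hp2 : 2 ≤ p := le_trans (by norm_num) hp
  have h2 : emin + 2 * p ≤ e₀ + e₀ := by omega
  unfold orient2dDet
  have fmt : ∀ {x y : ℚ}, IsFloat p e₀ x → IsFloat p e₀ y → IsFloat p e₀ (fl (x - y)) :=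
    fun hx hy => isFloat_of_isFloat_of_onGrid (hfl _).1
      (((OnGrid.of_isFloat hx).sub (OnGrid.of_isFloat hy)).fl_of hp1 hfl he₀)
  have h₁₂ : ExactTwoProd p emin fl tp (fl (a₁ - c₁)) (fl (b₂ - c₂)) :=
    htp _ _ (fmt ha₁ hc₁) (fmt hb₂ hc₂)
  have h₃₄ : ExactTwoProd p emin fl tp (fl (a₂ - c₂)) (fl (b₁ - c₁)) :=
    htp _ _ (fmt ha₂ hc₂) (fmt hb₁ hc₁)
  rcases hA : orient2dStageA fl (ccwerrboundA p) a₁ a₂ b₁ b₂ c₁ c₂ with _ | d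
  · rcases hB : orient2dStageB tp fl (ccwerrboundB p) (orient2dDetsum fl a₁ a₂ b₁ b₂ c₁ c₂)
        a₁ a₂ b₁ b₂ c₁ c₂ with _ | d
    · by_cases hT : (a₁ - c₁) - fl (a₁ - c₁) = 0 ∧ (b₂ - c₂) - fl (b₂ - c₂) = 0 ∧
        (a₂ - c₂) - fl (a₂ - c₂) = 0 ∧ (b₁ - c₁) - fl (b₁ - c₁) = 0
      · -- the tails-zero exit: the rigid configuration
        right
        rw [orient2dAdapt_of_tailsZero hA hB hT] at hr
        obtain ⟨e1, e2, e3, e4⟩ := hT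
        have f1 : fl (a₁ - c₁) = a₁ - c₁ := by linarith
        have f2 : fl (b₂ - c₂) = b₂ - c₂ := by linarith
        have f3 : fl (a₂ - c₂) = a₂ - c₂ := by linarith
        have f4 : fl (b₁ - c₁) = b₁ - c₁ := by linarith
        have hF1 : IsFloat p emin (a₁ - c₁) := by rw [← f1]; exact (hfl _).1
        have hF2 : IsFloat p emin (b₂ - c₂) := by rw [← f2]; exact (hfl _).1
        have hF3 : IsFloat p emin (a₂ - c₂) := by rw [← f3]; exact (hfl _).1
        have hF4 : IsFloat p emin (b₁ - c₁) := by rw [← f4]; exact (hfl _).1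
        rw [f1, f2] at h₁₂
        rw [f3, f4] at h₃₄
        exact ⟨hF1, hF2, hF3, hF4, orient2d_tailsZero_eq_zero hp2 hfl hfl2 hF1 hF2 hF3 hF4 h₁₂ h₃₄ hr⟩
      · rcases hC : orient2dStageC tp fl (ccwerrboundC p) (resulterrbound p)
            (orient2dDetsum fl a₁ a₂ b₁ b₂ c₁ c₂) a₁ a₂ b₁ b₂ c₁ c₂ with _ | d
        · -- stage D: `D = ⟨0⟩` iff `t_A = 0`
          left
          rw [orient2dAdapt_of_stageD hA hB hT hC] at hr
          obtain ⟨hD, hpos, hneg, -⟩ :=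
            orient2dExactWith_sign hp hfl hodd hfl2 hfes he₀ htp ha₁ ha₂ hb₁ hb₂ hc₁ hc₂
          rw [List.getLast?_eq_getLast_of_ne_nil hD, Option.getD_some] at hr
          unfold orient2dDet at hpos hneg
          exact eq_zero_of_sign_iff ⟨hpos.symm, hneg.symm⟩ hr
        · -- stage C never answers `0`
          left
          rw [orient2dAdapt_of_stageC hA hB hT hC] at hr
          exact eq_zero_of_sign_iff
            (orient2dStageC_correct hp hfl hfl2 he₀ h3 ha₁ ha₂ hb₁ hb₂ hc₁ hc₂ h₁₂ h₃₄ hA hC) hr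
    · -- stage B never answers `0`
      left
      rw [orient2dAdapt_of_stageB hA hB] at hr
      exact eq_zero_of_sign_iff
        (orient2dStageB_correct hp hfl hfl2 he₀ h2 ha₁ ha₂ hb₁ hb₂ hc₁ hc₂ h₁₂ h₃₄ hA hB) hr
  · -- stage A answers `0` iff `t_A = 0`
    left
    rw [orient2dAdapt_of_stageA hA] at hr
    exact eq_zero_of_sign_iff (orient2dStageA_correct hp hfl he₀ h2 ha₁ ha₂ hb₁ hb₂ hc₁ hc₂ hA) hr

end Summit.Ventures.CertifiedArithmetic.Expansions
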